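import Summits.Ventures.CertifiedArithmetic.LowPrec.SRFaithful
import Summits.Ventures.CertifiedArithmetic.LowPrec.SRFormatsBridge
import HarnessLib

/-!
# Stochastic rounding into a finite format, XXVIII: Fast2Sum under stochastic rounding

HONEST FRAMING: certified error envelopes and provably optimal rounding/accumulation schemes for
low-precision formats under stated cost models; every table by two implementations; no hardware or
vendor claims.

Venture CertifiedArithmetic / lowprec, SR slice (gen7). Dekker's Fast2Sum with a saturating mode-2
STOCHASTIC rounding at each of its three operations — `s = SR₁(a + b)`, `z = SR₂(s − a)`,
`t = SR₃(b − z)`, independent roundings into the value set `F` of a minifloat format (subnormals,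
saturation at `±maxRat`, no infinities) — as the expectation operator `fast2SumE F a b f = E f(s,t)`
(three nested `step`s of file I). For data `a, b` of ANY format with `|b| ≤ |a|`:

* `fast2SumE_eq` — **REDUCTION**: `z = s − a` surely (file XXVII `sub_mem_of_faithful`), so
  `E f(s,t) = E_s E_{t ~ SR(a+b−s)} f(s,t)`: `t` is ONE saturating SR rounding of the committed
  error `a + b − s`, which lies in the hull [BoldoGraillatMuller2017, Thm 3.1:
  `t = ∘₃((a+b) − s)` for faithful `∘ᵢ` without overflow — here with saturation, every format].
* `fast2SumE_add` — **UNBIASED COMPENSATION**: `E[s + t] = a + b` EXACTLY, for every ordered pair of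
  every format — including the pairs whose first rounding SATURATES, where `s` alone is biased
  (`E s = clamp(a+b) ≠ a + b`, file I `step_id_eq_self_iff`); kernel instance
  `fast2Sum_saturation_E2M1` (`6 + 4`: `E s = 6`, `E[s+t] = 10`, `t = 4` surely).
* `fast2SumE_exact_law` — **EXACTNESS LAW**: `P(s + t = a + b) = P(a + b − s ∈ F)`, the probability
  that the committed error is representable; `= 1` when both candidate errors are values
  (`fast2SumE_exact_of_mem`); and **`≥ 1/2` always** (`half_le_fast2SumE_exact`: the
  round-to-nearest candidate carries SR probability `≥ 1/2` and its error is a value,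
  `addErr_representable`).
* Kernel certificates over the literal value sets (file III/III′ tables = `valueSet`, bridge file):
  E2M1 — Fast2Sum under SR is EXACT SURELY on all `127` ordered pairs `|b| ≤ |a|`
  (`fast2SumE_exact_E2M1`, transported to `MiniFloat E2M1`); E3M2 — NOT surely exact:
  `a = 16, b = 7/4` gives `P(exact) = 9/16` (`fast2SumE_E3M2_witness`; candidates `16`/`20`, errors
  `7/4 ∈ F`, `−9/4 ∉ F`, `p↑ = 7/16`). The complete pair tables (E2M1, E3M2, E2M3: law of `(s,t)`,
  `P(exact)`, `E[s+t]`, 2Sum under SR) are the cell's two-implementation certificate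
  `certs/sr/gen7/eft/` (A ≡ B); E2M3 is surely exact on every ordered pair, E3M2's minimum is
  `9/16`.

Not here: 2Sum (six SR roundings) — by the same certificate it is unbiased on every ordered pair of
E2M1/E3M2/E2M3, surely exact in E2M1/E2M3 and has minimum `P(exact) = 81/256` in E3M2, but no Lean
theorem is claimed; formats with infinities.
-/

namespace Summit.Ventures.CertifiedArithmetic.LowPrec.SR

open Literature.ComputerArithmetic.ConnollyHighamMary2021 Finset

section Generic

variable {K : Type*} [Field K] [LinearOrder K] [IsStrictOrderedRing K]

/-- Fast2Sum EXECUTED UNDER SATURATING SR, as an expectation operator: `E f(s, t)` for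
`s = SR₁(a + b)`, `z = SR₂(s − a)`, `t = SR₃(b − z)`, the three roundings independent mode-2
stochastic roundings into `F` with saturation (file I `step`).
[cite: BoldoGraillatMuller2017, Algorithm 3 (Fast2Sum with faithful roundings); SR semantics new] -/
def fast2SumE (F : Finset K) (a b : K) (f : K → K → K) : K :=
  step F (a + b) fun s => step F (s - a) fun z => step F (b - z) fun t => f s t

omit [Field K] [IsStrictOrderedRing K] in
/-- Outside the hull the clamped value is an element of `F` (an extreme one). -/
theorem clamp_mem_of_not_inHull {F : Finset K} (hF : F.Nonempty) {c : K} (h : ¬ InHull F c) :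
    clamp F c ∈ F := by
  unfold clamp; rw [dif_pos hF]
  by_cases h1 : ∃ y ∈ F, y ≤ c
  · have h2 : ∀ y ∈ F, y < c := by
      intro y hy
      by_contra hle
      exact h ⟨h1, ⟨y, hy, not_lt.mp hle⟩⟩
    rw [min_eq_right (h2 _ (F.max'_mem hF)).le, max_eq_right (F.min'_le _ (F.max'_mem hF))]
    exact F.max'_mem hF
  · push Not at h1
    rw [min_eq_left (h1 _ (F.max'_mem hF)).le, max_eq_left (h1 _ (F.min'_mem hF)).le]
    exact F.min'_mem hF

omit [Field K] [IsStrictOrderedRing K] in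
/-- Outside the hull the two SR candidates coincide (saturation is deterministic). -/
theorem dn_eq_up_of_not_inHull {F : Finset K} (hF : F.Nonempty) {c : K} (h : ¬ InHull F c) :
    dn F c = up F c := by
  have hm := clamp_mem_of_not_inHull hF h
  unfold dn up
  rw [roundDown_eq_self_of_mem hm, roundUp_eq_self_of_mem hm]

omit [IsStrictOrderedRing K] in
/-- Inside the hull the up-probability is the CHM ratio of the unclamped value. -/
theorem pUp_eq_of_inHull {F : Finset K} {c : K} (h : InHull F c) :
    pUp F c = (c - dn F c) / (up F c - dn F c) := by
  unfold pUp probUp dn up; rw [clamp_eq_self h]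

/-- A NEAREST element of `F` to `c` is one of the two SR candidates of `c`. -/
theorem eq_dn_or_up_of_nearest {F : Finset K} {c r : K} (hr : r ∈ F)
    (hnear : ∀ y ∈ F, |c - r| ≤ |c - y|) : r = dn F c ∨ r = up F c := by
  have hF : F.Nonempty := ⟨r, hr⟩
  by_contra h
  push Not at h
  rcases le_total r c with hrc | hcr
  · have h1 : r ≤ dn F c := le_dn_of_mem hr hrc
    have h2 : dn F c ≤ c := (dn_le_clamp F c).trans (clamp_le_self_of_mem hr hrc)
    have h3 : r < dn F c := lt_of_le_of_ne h1 h.1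
    have h4 := hnear _ (dn_mem hF c)
    rw [abs_of_nonneg (by linarith), abs_of_nonneg (by linarith)] at h4
    linarith
  · have h1 : up F c ≤ r := up_le_of_mem hr hcr
    have h2 : c ≤ up F c := (self_le_clamp_of_mem hr hcr).trans (clamp_le_up F c)
    have h3 : up F c < r := lt_of_le_of_ne h1 (Ne.symm h.2)
    have h4 := hnear _ (up_mem hF c)
    rw [abs_of_nonpos (by linarith), abs_of_nonpos (by linarith)] at h4
    linarith

end Generic

section Formats

open Literature.ComputerArithmetic.FloatingPoint
open Literature.ComputerArithmetic.FloatingPoint.MiniFloat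

variable {φ : Format}

/-! ### Reduction: the inner subtraction is exact, `t` is one SR rounding of the error -/

/-- **REDUCTION.** Under SR with `|b| ≤ |a|`, `z = SR(s − a) = s − a` surely, hence
`E f(s,t) = E_s [ E_{t ∼ SR(a + b − s)} f(s,t) ]`: the returned `t` is one saturating SR rounding of
the committed error `a + b − s`. [cite: BoldoGraillatMuller2017, Thm 3.1 (faithful roundings, no
overflow); SR with saturation, every format: new] -/
theorem fast2SumE_eq (a b : MiniFloat φ) (hab : |b.toRat| ≤ |a.toRat|) (f : ℚ → ℚ → ℚ) :
    fast2SumE (valueSet φ) a.toRat b.toRat f =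
      step (valueSet φ) (a.toRat + b.toRat) fun s =>
        step (valueSet φ) (a.toRat + b.toRat - s) (f s) := by
  unfold fast2SumE
  refine step_congr_faithful (valueSet_nonempty φ) _ fun s hs => ?_
  simp only [step_of_mem (sub_mem_of_faithful a b hab hs)]
  rw [show b.toRat - (s - a.toRat) = a.toRat + b.toRat - s by ring]

/-! ### Unbiased compensation -/

/-- **`E[s + t] = a + b` EXACTLY** — every format, every ordered pair `|b| ≤ |a|`, saturation of the
first rounding included (there `E s ≠ a + b` but the compensated pair is still unbiased). -/
theorem fast2SumE_add (a b : MiniFloat φ) (hab : |b.toRat| ≤ |a.toRat|) :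
    fast2SumE (valueSet φ) a.toRat b.toRat (fun s t => s + t) = a.toRat + b.toRat := by
  rw [fast2SumE_eq a b hab]
  refine step_eq_of_faithful (valueSet_nonempty φ) _ fun s hs => ?_
  have h := inHull_err_of_faithful a b hs
  have e : step (valueSet φ) (a.toRat + b.toRat - s) (fun t => s + t)
      = step (valueSet φ) (a.toRat + b.toRat - s) (fun _ => s)
        + step (valueSet φ) (a.toRat + b.toRat - s) (fun t => t) := by
    rw [← step_add]
  rw [e, step_const, step_id, clamp_eq_self h]; ring

/-- By contrast the first rounding alone is biased exactly when `a + b` leaves the hull: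
`E s = a + b ↔ |a + b| ≤ maxRat`. -/
theorem step_sum_unbiased_iff (a b : MiniFloat φ) :
    step (valueSet φ) (a.toRat + b.toRat) (fun s => s) = a.toRat + b.toRat ↔
      |a.toRat + b.toRat| ≤ φ.maxRat := by
  rw [step_id_eq_self_iff (valueSet_nonempty φ), valueSet_inHull_iff]

/-! ### The exactness law -/

/-- **EXACTNESS LAW.** `P(s + t = a + b) = P(a + b − s ∈ F)`: Fast2Sum under SR returns the exact
error iff the error committed by the first rounding is a value of the format (then `t` is that
value surely; otherwise `t` is one of the two neighbours of the error, never the error). -/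
theorem fast2SumE_exact_law (a b : MiniFloat φ) (hab : |b.toRat| ≤ |a.toRat|) :
    fast2SumE (valueSet φ) a.toRat b.toRat
        (fun s t => if s + t = a.toRat + b.toRat then 1 else 0)
      = step (valueSet φ) (a.toRat + b.toRat)
          (fun s => if a.toRat + b.toRat - s ∈ valueSet φ then 1 else 0) := by
  rw [fast2SumE_eq a b hab]
  refine step_congr_faithful (valueSet_nonempty φ) _ fun s hs => ?_
  by_cases hmem : a.toRat + b.toRat - s ∈ valueSet φ
  · rw [if_pos hmem, step_of_mem hmem, if_pos (by ring)]
  · rw [if_neg hmem]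
    refine step_eq_of_faithful (valueSet_nonempty φ) _ fun t ht => ?_
    rw [if_neg]
    intro h
    exact hmem (by rw [show a.toRat + b.toRat - s = t by linarith]; exact ht.mem)

/-- SURE EXACTNESS: if both candidate errors `a + b − ⌊a+b⌋`, `a + b − ⌈a+b⌉` (saturating
candidates) are values, Fast2Sum under SR returns the exact error with probability `1`. -/
theorem fast2SumE_exact_of_mem (a b : MiniFloat φ) (hab : |b.toRat| ≤ |a.toRat|)
    (hdn : a.toRat + b.toRat - dn (valueSet φ) (a.toRat + b.toRat) ∈ valueSet φ)
    (hup : a.toRat + b.toRat - up (valueSet φ) (a.toRat + b.toRat) ∈ valueSet φ) :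
    fast2SumE (valueSet φ) a.toRat b.toRat
        (fun s t => if s + t = a.toRat + b.toRat then 1 else 0) = 1 := by
  rw [fast2SumE_exact_law a b hab,
    step_congr (valueSet φ) (a.toRat + b.toRat)
      (f := fun s => if a.toRat + b.toRat - s ∈ valueSet φ then (1 : ℚ) else 0)
      (g := fun _ => (1 : ℚ)) (by simp only [if_pos hup]) (by simp only [if_pos hdn]),
    step_const]

/-- The round-to-nearest value of `c` is one of the two saturating SR candidates of `c`. -/
theorem toRat_roundNE_eq_dn_or_up (c : ℚ) :
    (roundNE φ c).toRat = dn (valueSet φ) c ∨ (roundNE φ c).toRat = up (valueSet φ) c :=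
  eq_dn_or_up_of_nearest (toRat_mem_valueSet _) fun y hy => by
    obtain ⟨y', rfl⟩ := mem_valueSet.mp hy
    exact roundNE_nearest c y'

/-- If the round-to-nearest error `c − fl(c)` is a value, one SR rounding of `c` followed by the
indicator "the committed error is a value" has expectation `≥ 1/2`: the nearest candidate carries
SR probability `≥ 1/2`. -/
theorem half_le_step_err_mem (c : ℚ) (herr : c - (roundNE φ c).toRat ∈ valueSet φ) :
    1 / 2 ≤ step (valueSet φ) c (fun s => if c - s ∈ valueSet φ then 1 else 0) := by
  have hru := toRat_roundNE_eq_dn_or_up (φ := φ) c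
  obtain ⟨u', hu'⟩ := mem_valueSet.mp (up_mem (valueSet_nonempty φ) c)
  obtain ⟨d', hd'⟩ := mem_valueSet.mp (dn_mem (valueSet_nonempty φ) c)
  have hnu := roundNE_nearest (φ := φ) c u'
  have hnd := roundNE_nearest (φ := φ) c d'
  rw [hu'] at hnu
  rw [hd'] at hnd
  have hF : (valueSet φ).Nonempty := valueSet_nonempty φ
  set F := valueSet φ with hF_def
  set r := (roundNE φ c).toRat with hr_def
  have hp0 := pUp_nonneg F c
  have hp1 := pUp_le_one F c
  unfold step
  beta_reduce
  by_cases hdu : dn F c = up F c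
  · -- deterministic (or degenerate) step: both candidates are the nearest value
    have hr : r = dn F c := by
      rcases hru with h | h
      · exact h
      · rw [h, ← hdu]
    rw [hr] at herr
    rw [← hdu, if_pos herr]
    linarith
  · have hin : InHull F c := by
      by_contra h
      exact hdu (dn_eq_up_of_not_inHull hF h)
    have hp : pUp F c = (c - dn F c) / (up F c - dn F c) := pUp_eq_of_inHull hin
    have hdc : dn F c ≤ c := by simpa only [clamp_eq_self hin] using dn_le_clamp F c
    have hcu : c ≤ up F c := by simpa only [clamp_eq_self hin] using clamp_le_up F c
    have hlt : dn F c < up F c := lt_of_le_of_ne (hdc.trans hcu) hdu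
    have hXu0 : (0 : ℚ) ≤ (if c - up F c ∈ F then 1 else 0) := by split <;> norm_num
    have hXd0 : (0 : ℚ) ≤ (if c - dn F c ∈ F then 1 else 0) := by split <;> norm_num
    rcases hru with hr | hr
    · -- nearest is the lower candidate: `p↑ ≤ 1/2`, and the lower error is a value
      rw [hr] at herr hnu
      rw [abs_of_nonneg (by linarith), abs_of_nonpos (by linarith)] at hnu
      rw [if_pos herr]
      have hp2 : pUp F c ≤ 1 / 2 := by
        rw [hp, div_le_iff₀ (by linarith)]; linarith
      nlinarith
    · -- nearest is the upper candidate: `p↑ ≥ 1/2`, and the upper error is a value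
      rw [hr] at herr hnd
      rw [abs_of_nonpos (by linarith), abs_of_nonneg (by linarith)] at hnd
      rw [if_pos herr]
      have hp2 : 1 / 2 ≤ pUp F c := by
        rw [hp, le_div_iff₀ (by linarith)]; linarith
      nlinarith

/-- **`P(exact) ≥ 1/2` in every format.** The round-to-nearest candidate of `a + b` has SR
probability `≥ 1/2` and its error is a value (`addErr_representable`). -/
theorem half_le_fast2SumE_exact (a b : MiniFloat φ) (hab : |b.toRat| ≤ |a.toRat|) :
    1 / 2 ≤ fast2SumE (valueSet φ) a.toRat b.toRat
        (fun s t => if s + t = a.toRat + b.toRat then 1 else 0) := by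
  rw [fast2SumE_exact_law a b hab]
  obtain ⟨e, he⟩ := addErr_representable a b
  exact half_le_step_err_mem _ (mem_valueSet.mpr ⟨e, he⟩)

/-! ### Kernel certificates (FP4 / FP6 literal value sets) -/

/-- SATURATING PAIR, E2M1 `a = 6`, `b = 4` (`a + b = 10 > maxRat = 6`): the SR sum alone is `6`
surely (biased by `−4`), yet Fast2Sum under SR returns `t = 4` surely and `E[s + t] = 10`. -/
theorem fast2Sum_saturation_E2M1 :
    step FP4.e2m1 ((6 : ℚ) + 4) (fun s => s) = 6 ∧
    fast2SumE FP4.e2m1 6 4 (fun _ t => if t = 4 then 1 else 0) = 1 ∧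
    fast2SumE FP4.e2m1 6 4 (fun s t => s + t) = 10 := by
  refine ⟨by decide +kernel, by decide +kernel, by decide +kernel⟩

/-- **E2M1: Fast2Sum under SR is exact SURELY on every ordered pair** of the FP4 value set
(kernel evaluation of the three nested SR steps over all `127` ordered pairs `|b| ≤ |a|` of the
`15` values). -/
theorem fast2SumE_exact_e2m1 : ∀ a ∈ FP4.e2m1, ∀ b ∈ FP4.e2m1, |b| ≤ |a| →
    fast2SumE FP4.e2m1 a b (fun s t => if s + t = a + b then 1 else 0) = 1 := by
  decide +kernel

/-- E2M1, substrate form: for all data `a, b : MiniFloat E2M1` with `|b| ≤ |a|`, Fast2Sum under SR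
into `valueSet E2M1` returns the exact error with probability `1`. -/
theorem fast2SumE_exact_E2M1 (a b : MiniFloat Format.E2M1) (hab : |b.toRat| ≤ |a.toRat|) :
    fast2SumE (valueSet Format.E2M1) a.toRat b.toRat
      (fun s t => if s + t = a.toRat + b.toRat then 1 else 0) = 1 := by
  rw [← e2m1_eq_valueSet]
  exact fast2SumE_exact_e2m1 _ (e2m1_eq_valueSet ▸ toRat_mem_valueSet a) _
    (e2m1_eq_valueSet ▸ toRat_mem_valueSet b) hab

/-- **E3M2 is NOT surely exact**: `a = 16`, `b = 7/4` — candidates `16` (error `7/4 ∈ F`) and `20`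
(error `−9/4 ∉ F`), `p↑ = 7/16`, so `P(s + t = a + b) = 9/16`; still `E[s + t] = 71/4 = a + b`.
(The cell's certificate `certs/sr/gen7/eft/` shows `9/16` is the minimum over all E3M2 pairs.) -/
theorem fast2SumE_E3M2_witness :
    dn Formats.e3m2 ((16 : ℚ) + 7 / 4) = 16 ∧ up Formats.e3m2 ((16 : ℚ) + 7 / 4) = 20 ∧
    pUp Formats.e3m2 ((16 : ℚ) + 7 / 4) = 7 / 16 ∧ (9 : ℚ) / 4 ∉ Formats.e3m2 ∧
    fast2SumE Formats.e3m2 16 (7 / 4) (fun s t => if s + t = 16 + 7 / 4 then 1 else 0) = 9 / 16 ∧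
    fast2SumE Formats.e3m2 16 (7 / 4) (fun s t => s + t) = 71 / 4 := by
  refine ⟨by decide +kernel, by decide +kernel, by decide +kernel, by decide +kernel,
    by decide +kernel, by decide +kernel⟩

/-- E3M2 witness, substrate form: there are data `a, b : MiniFloat E3M2` with `|b| ≤ |a|` on which
Fast2Sum under SR is exact with probability exactly `9/16 < 1`. -/
theorem fast2SumE_not_sure_E3M2 : ∃ a b : MiniFloat Format.E3M2, |b.toRat| ≤ |a.toRat| ∧
    fast2SumE (valueSet Format.E3M2) a.toRat b.toRat
      (fun s t => if s + t = a.toRat + b.toRat then 1 else 0) = 9 / 16 := by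
  have h16 : (16 : ℚ) ∈ valueSet Format.E3M2 := by rw [← e3m2_eq_valueSet]; decide +kernel
  have h74 : (7 / 4 : ℚ) ∈ valueSet Format.E3M2 := by rw [← e3m2_eq_valueSet]; decide +kernel
  obtain ⟨a, ha⟩ := mem_valueSet.mp h16
  obtain ⟨b, hb⟩ := mem_valueSet.mp h74
  refine ⟨a, b, by rw [ha, hb]; norm_num, ?_⟩
  rw [ha, hb, ← e3m2_eq_valueSet]
  exact fast2SumE_E3M2_witness.2.2.2.2.1

end Formats

end Summit.Ventures.CertifiedArithmetic.LowPrec.SR
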